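import Summits.CriticalPhenomena.Ising3DConformalLimit.Theorems.PrecisionLaplacianDirectCorrelationStableTailConverseSpine
import Summits.CriticalPhenomena.Ising3DConformalLimit.Theorems.PrecisionLaplacianDirectCorrelationStableTailLogicalMap
import HarnessLib

/-!
# Split scratch — crux `PrecisionLaplacian.DirectCorrelationStableTail` (stmt-CriticalPhenomena-4799)
# into the two EXISTING items 0634 (isotropic pure power law) and 1342 (NonSaturation).

Strategist `planner-cstrat-stmt-CriticalPhenomena-4799-p1-0`, 2026-08-17.  The children are written out VERBATIM as the
registered signatures of items stmt-CriticalPhenomena-0634 and stmt-CriticalPhenomena-1342 (so that the gate's signature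
dedup attaches route PrecisionLaplacian to those items), and the glue `DirectCorrelationStableTail_of_subs` is the landed
converse two-point spine `DirectCorrelationStableTail_of` (p138781) up to argument order and definitional unfolding.
-/

namespace Summit.CriticalPhenomena.Ising3DConformalLimit.Cruxes.DirectCorrelationStableTail.Split

open Summit.CriticalPhenomena.Ising3DConformalLimit.Theses

/-- Child 1 = item stmt-CriticalPhenomena-0634 verbatim (IsingEuclidUpgrade r2). -/
def ChildTwoPointLaw : Prop :=
  ∃ Δ c : ℝ, 0 < c ∧ Filter.Tendsto (fun x : Literature.Probability.LatticeModels.Site 3 => Literature.Probability.LatticeModels.criticalTwoPoint 3 x * Real.sqrt (∑ i, ((x i : ℝ)) ^ 2) ^ (2 * Δ)) Filter.cofinite (nhds c)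

/-- Child 2 = item stmt-CriticalPhenomena-1342 verbatim (PerfectScreening.NonSaturation). -/
def ChildNonSaturation : Prop :=
  ∀ ε : ℝ, 0 < ε → ∃ᶠ n : ℕ in Filter.atTop, (n : ℝ) * Literature.Probability.LatticeModels.criticalTwoPoint 3 (Pi.single 0 (n : ℤ)) < ε

/-- The children ARE the other routes' decls, definitionally. -/
theorem childTwoPointLaw_iff : ChildTwoPointLaw ↔ IsingEuclidUpgrade.IsingEuclidUpgradeR2RotInvPowerLaw := Iff.rfl
theorem childNonSaturation_iff : ChildNonSaturation ↔ PerfectScreening.NonSaturation := Iff.rfl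

/-- **Split glue** `C₁ → C₂ → C`: the two children imply the crux BY NAME (one line from p138781). -/
theorem DirectCorrelationStableTail_of_subs :
    ChildTwoPointLaw → ChildNonSaturation → PrecisionLaplacian.DirectCorrelationStableTail :=
  fun hR2 hNS => DiffusiveBranchIsNonsaturation.DirectCorrelationStableTail_of hNS hR2

/-- The same glue stated over the sibling routes' decl names (what a prover lands for the generated glue item). -/
theorem DirectCorrelationStableTail_of_subs' :
    IsingEuclidUpgrade.IsingEuclidUpgradeR2RotInvPowerLaw → PerfectScreening.NonSaturation →
      PrecisionLaplacian.DirectCorrelationStableTail :=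
  fun hR2 hNS => DiffusiveBranchIsNonsaturation.DirectCorrelationStableTail_of hNS hR2

/-- Faithfulness of the split (modulo the crux's own antecedent `H`): crux ∧ H ⇒ both children
(hypothesis-free logical map p139683).  So under `H` (⇐ IM, item 4798, via the proved support 4802)
the family {children} is EQUIVALENT to the parent — the split loses nothing and adds nothing. -/
theorem subs_of_DirectCorrelationStableTail
    (hT : PrecisionLaplacian.DirectCorrelationStableTail)
    (hH : ∀ A : Finset (Literature.Probability.LatticeModels.Site 3),
      (Matrix.of fun (p q : ↥A) => Literature.Probability.LatticeModels.criticalTwoPoint 3 (q.1 - p.1)).PosDef ∧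
        ∀ u v : ↥A, (u ≠ v → (Matrix.of fun (p q : ↥A) =>
          Literature.Probability.LatticeModels.criticalTwoPoint 3 (q.1 - p.1))⁻¹ u v ≤ 0) ∧
          0 ≤ ∑ w, (Matrix.of fun (p q : ↥A) => Literature.Probability.LatticeModels.criticalTwoPoint 3 (q.1 - p.1))⁻¹ u w) :
    ChildTwoPointLaw ∧ ChildNonSaturation :=
  (DiffusiveBranchIsNonsaturation.directCorrelationStableTail_iff_symmPotential_imp.1 hT) hH

/-- Neither child is the crux reworded, I: child 1 with exponent `Δ = 1/2` (Coulomb law) REFUTES the crux under `H`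
(p139683), so child 1 alone does not imply it. -/
theorem child1_coulomb_refutes
    (hH : ∀ A : Finset (Literature.Probability.LatticeModels.Site 3),
      (Matrix.of fun (p q : ↥A) => Literature.Probability.LatticeModels.criticalTwoPoint 3 (q.1 - p.1)).PosDef ∧
        ∀ u v : ↥A, (u ≠ v → (Matrix.of fun (p q : ↥A) =>
          Literature.Probability.LatticeModels.criticalTwoPoint 3 (q.1 - p.1))⁻¹ u v ≤ 0) ∧
          0 ≤ ∑ w, (Matrix.of fun (p q : ↥A) => Literature.Probability.LatticeModels.criticalTwoPoint 3 (q.1 - p.1))⁻¹ u w)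
    {c : ℝ} (hc : 0 < c)
    (hT : Filter.Tendsto (fun x : Literature.Probability.LatticeModels.Site 3 =>
      Literature.Probability.LatticeModels.criticalTwoPoint 3 x * Real.sqrt (∑ i, ((x i : ℝ)) ^ 2))
      Filter.cofinite (nhds c)) :
    ¬ PrecisionLaplacian.DirectCorrelationStableTail :=
  DiffusiveBranchIsNonsaturation.not_directCorrelationStableTail_of_symmPotential_of_coulomb hH hc hT

#print axioms DirectCorrelationStableTail_of_subs

end Summit.CriticalPhenomena.Ising3DConformalLimit.Cruxes.DirectCorrelationStableTail.Split
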